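import Summits.AtomisticToContinuum.HydrodynamicLimit.Theorems.InformationPercolationEngineChaosClosesEulerLocalEquilibriumFromDissipationE
import HarnessLib

/-!
# Pointwise local equilibrium from the empirical H-theorem (crux `ChaosClosesEuler`, stmt-AtomisticToContinuum-15141,
# line `empirical-h-theorem`, stub `stub_localEquilibriumFromDissipation`) — helper F: positivity transfer

WHAT. `predField_window_le` — THE POSITIVITY STEP of the empirical H-theorem, pathwise along ONE good orbit: since the
Enskog integrand `F = h(ρ_r) Y(σ³ρ_r) 𝒫 ≥ 0` (Boltzmann's inequality), its space–time integral over `[0, t] × 𝕋³` is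
controlled by the WINDOW `L¹(dt₀ dx₀)`-norm of its tent × cone window `R` over `[0, τ] × 𝕋³` (`t + r ≤ τ`: half of every
tent centred in `[0, t]` lies in `[0, τ]`, `half_le_setIntegral_tent`; window transpose `integral_integral_mul_window_eq`
of `PressureValueE`), and `∫∫ R ≤ ∫∫ |Kr − R| + ∫∫ |Kent − Kr| + ∫∫ |Kent|`:
`∫₀ᵗ∫ₓ F ≤ (2/σ³) (∫∫|Kr − R| + C_h(2A+4)·K_N[(1+|v|²+|w|²)1{>L}] + τ · sup|Kent|)` (helper D for the middle term).
Also `q4_le`: the quartic collision functional `Q4` of `WindowedEntropyBalance` is at most twice the tightness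
functional of `CollisionMeasureChaos.CollisionTightness` (elastic reflection conserves the pair energy,
`|v|⁴ + |w|⁴ ≤ (|v|² + |w|²)² ≤ 2(|v⁻|⁴ + |w⁻|⁴)`).

References: C. Cercignani, R. Illner, M. Pulvirenti (1994) §3.2 (H-theorem); M. Pulvirenti, S. Simonella,
arXiv:1504.03215 §3. No named fact is invoked.
-/

noncomputable section

namespace Summit.AtomisticToContinuum.HydrodynamicLimit.Theorems.ChaosClosesEulerLocalEquilibriumFromDissipation

open scoped BigOperators Topology Classical MeasureTheory ENNReal InnerProductSpace
open Filter Set MeasureTheory Function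
open Literature.MathematicalPhysics.KineticTheory
open Literature.Analysis.FluidPDE
open Summit.AtomisticToContinuum.HydrodynamicLimit.Theorems.LocalSecondLawNegative
open Summit.AtomisticToContinuum.HydrodynamicLimit.Theorems.LocalSecondLawLedger
open Summit.AtomisticToContinuum.HydrodynamicLimit.Theorems.ChaosClosesEulerPressureValue
  (finite_collisionTimes_Icc integrable_tent_sub setIntegral_tent_le_one setIntegral_tent_nonneg continuous_tent_sub
    half_le_setIntegral_tent measurable_windowField abs_windowField_le integrable_slice integrableOn_integral_slice
    abs_setIntegral_integral_le setIntegral_integral_add setIntegral_integral_const_mul abs_setIntegral_integral_le_of_le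
    setIntegral_integral_mono_set integral_integral_mul_window_eq)
open Summit.AtomisticToContinuum.HydrodynamicLimit.Theorems.ChaosClosesEulerWindowedInvariance (tent_nonneg_le)

variable {σ : ℝ} {N : ℕ}

section Transfer

variable (Φ : HardSphereFlow (Torus.geometry (Fin 3)) (hsDiameter σ N) (N + 1)) {z : Phase N}

/-- The windowed tent mass `c(s) = ∫_{t₀ ∈ [0,τ]} bt(s − t₀) dt₀` is continuous in `s`. [folklore] -/
theorem continuous_tentMass (r τ : ℝ) : Continuous fun s : ℝ => ∫ t₀ in Set.Icc 0 τ, r⁻¹ * max (1 - |s - t₀| / r) 0 := by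
  have hf : Continuous (Function.uncurry fun (s t₀ : ℝ) => r⁻¹ * max (1 - |s - t₀| / r) 0) := by
    unfold Function.uncurry; fun_prop
  exact continuous_parametric_integral_of_continuous (μ := (volume : Measure ℝ)) hf isCompact_Icc

/-- The smoothed unit coefficient: `∫_{t₀ ∈ [0,τ]} ∫_{x₀} 1 · (bt(s − t₀) b_r(x, x₀)) = ∫_{t₀ ∈ [0,τ]} bt(s − t₀)`
(`0 < r < 1/2`). [folklore] -/
theorem smoothOne_eq {r : ℝ} (hr : 0 < r) (hr2 : r < 1 / 2) (τ s : ℝ) (x : T3) :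
    (∫ t₀ in Set.Icc 0 τ, ∫ x₀ : T3, (fun _ : ℝ × T3 => (1 : ℝ)) (t₀, x₀) * (r⁻¹ * max (1 - |s - t₀| / r) 0 * cone r x x₀)) =
      ∫ t₀ in Set.Icc 0 τ, r⁻¹ * max (1 - |s - t₀| / r) 0 := by
  refine setIntegral_congr_fun measurableSet_Icc fun t₀ _ => ?_
  have h1 : ∫ x₀, cone r x x₀ = 1 := integral_cone_eq_one hr hr2 x
  simp only [one_mul]
  rw [integral_const_mul, h1, mul_one]

/-- **POSITIVITY TRANSFER (the empirical H-theorem step), pathwise.** Along a good orbit, for a density weight `h`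
(continuous, `|h| ≤ C_h`, `h = 0` on `[ρ̄, ∞)`, `ρ̄ ≥ 0`) and a measurable `Y` with `0 ≤ h(a)Y(σ³a) ≤ C_Y`... (only
`|hY| ≤ C_Y`, `hY ≥ 0` are used), if `|Kent| ≤ W` on all windows then for `0 ≤ t`, `t + r ≤ τ`:
`∫_{s∈[0,t]} ∫ₓ h(ρ_r) Y(σ³ρ_r) 𝒫 ≤ (2/σ³) (∫_{t₀∈[0,τ]}∫_{x₀} |Kr − R| + C_h(2A+4) K_N[(1+|vᵢ|²+|vⱼ|²)1{>L}] + τ W)`.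
[folklore] -/
theorem predField_window_le (hz : z ∈ Φ.good) (hσ : 0 < σ) {r : ℝ} (hr : 0 < r) (hr2 : r < 1 / 2) {δ : ℝ}
    (hδ : 0 < δ) (K L : ℝ) {t τ : ℝ} (ht : 0 ≤ t) (htτ : t + r ≤ τ) {h Y : ℝ → ℝ} (hh : Continuous h)
    (hY : Measurable Y) {Ch CY ρb : ℝ} (hCh : ∀ a, |h a| ≤ Ch) (hhY : ∀ a, |h a * Y (σ ^ 3 * a)| ≤ CY)
    (hhY0 : ∀ a, 0 ≤ h a * Y (σ ^ 3 * a)) (hh0 : ∀ a, ρb ≤ a → h a = 0) (hρb : 0 ≤ ρb) {W : ℝ}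
    (hW : ∀ t₀ x₀, |kentW Φ τ r δ K h z t₀ x₀| ≤ W) :
    ∫ s in Set.Icc 0 t, ∫ x, predField Φ σ r δ K L h Y z s x ≤
      2 / σ ^ 3 * ((∫ t₀ in Set.Icc 0 τ, ∫ x₀, |krW Φ τ r δ K L h z t₀ x₀ - rW Φ σ τ r δ K L h Y z t₀ x₀|) +
        Ch * (2 * ALam K δ ρb + 4) * csum Φ τ (fun s i j =>
          if L < ‖(Φ.flow s z i).2‖ ^ 2 + ‖(Φ.flow s z j).2‖ ^ 2 then
            1 + ‖(Φ.flow s z i).2‖ ^ 2 + ‖(Φ.flow s z j).2‖ ^ 2 else 0) z + τ * W) := by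
  have hτ : 0 ≤ τ := by linarith
  have hσ3 : 0 < σ ^ 3 := pow_pos hσ 3
  -- the Enskog integrand as a bounded measurable nonnegative field
  set F : ℝ → T3 → ℝ := predField Φ σ r δ K L h Y z with hFdef
  have hFm : Measurable (uncurry F) := measurable_predField Φ hz σ r δ K L hh hY
  have hFb : ∀ s x, |F s x| ≤ CY * predBound L (ALam K δ ρb + 2 * max L 0) :=
    abs_predField_le Φ hr hδ σ K L hhY hh0 hρb z
  have hF0 : ∀ s x, 0 ≤ F s x := predField_nonneg Φ hr hδ σ K L hhY0 z
  -- the windowed tent mass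
  set c : ℝ → ℝ := fun s => ∫ t₀ in Set.Icc 0 τ, r⁻¹ * max (1 - |s - t₀| / r) 0 with hcdef
  have hc01 : ∀ s, 0 ≤ c s ∧ c s ≤ 1 := fun s => ⟨setIntegral_tent_nonneg hr s _, setIntegral_tent_le_one hr s _⟩
  have hchalf : ∀ s ∈ Set.Icc 0 t, 1 / 2 ≤ c s := fun s hs =>
    half_le_setIntegral_tent hr hs.1 (by linarith [hs.2])
  have hcm : Measurable c := (continuous_tentMass r τ).measurable
  -- the field `2 c F`
  set G : ℝ → T3 → ℝ := fun s x => 2 * (c s * F s x) with hGdef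
  have hGm : Measurable (uncurry G) := ((hcm.comp measurable_fst).mul hFm).const_mul 2
  have hGb : ∀ s x, |G s x| ≤ 2 * (CY * predBound L (ALam K δ ρb + 2 * max L 0)) := fun s x => by
    rw [hGdef]; dsimp only
    rw [abs_mul, abs_of_pos (by norm_num : (0 : ℝ) < 2), abs_mul, abs_of_nonneg (hc01 s).1]
    exact mul_le_mul_of_nonneg_left ((mul_le_of_le_one_left (abs_nonneg _) (hc01 s).2).trans (hFb s x)) zero_le_two
  have hG0 : ∀ s x, 0 ≤ G s x := fun s x => mul_nonneg zero_le_two (mul_nonneg (hc01 s).1 (hF0 s x))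
  -- Step 1: `∫₀ᵗ∫ F ≤ ∫₀^τ∫ 2 c F`
  have h1 : ∫ s in Set.Icc 0 t, ∫ x, F s x ≤ ∫ s in Set.Icc 0 τ, ∫ x, G s x := by
    have hFG : ∀ s ∈ Set.Icc 0 t, ∀ x, |F s x| ≤ G s x := fun s hs x => by
      rw [abs_of_nonneg (hF0 s x), hGdef]; dsimp only
      nlinarith [hchalf s hs, hF0 s x]
    calc ∫ s in Set.Icc 0 t, ∫ x, F s x ≤ |∫ s in Set.Icc 0 t, ∫ x, F s x| := le_abs_self _
      _ ≤ ∫ s in Set.Icc 0 t, ∫ x, G s x := abs_setIntegral_integral_le_of_le hGm hGb hFG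
      _ ≤ ∫ s in Set.Icc 0 τ, ∫ x, G s x := setIntegral_integral_mono_set hGm hGb hG0 (Icc_subset_Icc le_rfl (by linarith))
  -- Step 2: `σ³ ∫₀^τ∫ c F = ∫∫ R` (window transpose with the unit coefficient)
  have h2 : ∫ t₀ in Set.Icc 0 τ, ∫ x₀, rW Φ σ τ r δ K L h Y z t₀ x₀ = σ ^ 3 * ∫ s in Set.Icc 0 τ, ∫ x, c s * F s x := by
    have hT := integral_integral_mul_window_eq (a := fun _ : ℝ × T3 => (1 : ℝ)) continuous_const (A := 1)
      (fun _ => by simp) hr hFm hFb σ 0 τ τ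
    have hL : (fun t₀ => ∫ x₀, (fun _ : ℝ × T3 => (1 : ℝ)) (t₀, x₀) *
        (σ ^ 3 * ∫ s in Set.Icc 0 τ, r⁻¹ * max (1 - |s - t₀| / r) 0 * ∫ x, cone r x x₀ * F s x)) =
        fun t₀ => ∫ x₀, rW Φ σ τ r δ K L h Y z t₀ x₀ := by
      funext t₀; simp only [one_mul]; rfl
    rw [hL] at hT
    rw [hT]
    congr 1
    refine setIntegral_congr_fun measurableSet_Icc fun s _ => integral_congr_ae (ae_of_all _ fun x => ?_)
    show (∫ t₀ in Set.Icc 0 τ, ∫ x₀ : T3, (fun _ : ℝ × T3 => (1 : ℝ)) (t₀, x₀) *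
      (r⁻¹ * max (1 - |s - t₀| / r) 0 * cone r x x₀)) * F s x = c s * F s x
    rw [smoothOne_eq hr hr2 τ s x]
  -- Step 3: `∫∫ R ≤ ∫∫|Kr − R| + ∫∫|Kent − Kr| + ∫∫|Kent|`
  obtain ⟨hKm, CK, hKb⟩ := kentW_facts Φ hz hσ hr hr2 hδ τ K hh hCh hh0 hρb
  obtain ⟨hKrm, CKr, hKrb⟩ := krW_facts Φ hz hσ hr hr2 hδ τ K L hh hCh hh0 hρb
  have hRm := measurable_rW Φ hz hr hδ σ τ K L hh hY hhY hh0 hρb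
  have hRb := abs_rW_le Φ hr hr2 hδ hσ.le τ K L hhY hh0 hρb z
  set A1 : ℝ → T3 → ℝ := fun t₀ x₀ => |krW Φ τ r δ K L h z t₀ x₀ - rW Φ σ τ r δ K L h Y z t₀ x₀| with hA1
  set A2 : ℝ → T3 → ℝ := fun t₀ x₀ => |kentW Φ τ r δ K h z t₀ x₀ - krW Φ τ r δ K L h z t₀ x₀| with hA2
  set A3 : ℝ → T3 → ℝ := fun t₀ x₀ => |kentW Φ τ r δ K h z t₀ x₀| with hA3
  have hA1m : Measurable (uncurry A1) := (hKrm.sub hRm).abs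
  have hA2m : Measurable (uncurry A2) := (hKm.sub hKrm).abs
  have hA3m : Measurable (uncurry A3) := hKm.abs
  have hA1b : ∀ t₀ x₀, |A1 t₀ x₀| ≤ CKr + σ ^ 3 * (CY * predBound L (ALam K δ ρb + 2 * max L 0)) := fun t₀ x₀ => by
    rw [hA1]; dsimp only; rw [abs_abs]; exact (abs_sub _ _).trans (add_le_add (hKrb t₀ x₀) (hRb t₀ x₀))
  have hA2b : ∀ t₀ x₀, |A2 t₀ x₀| ≤ CK + CKr := fun t₀ x₀ => by
    rw [hA2]; dsimp only; rw [abs_abs]; exact (abs_sub _ _).trans (add_le_add (hKb t₀ x₀) (hKrb t₀ x₀))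
  have hA3b : ∀ t₀ x₀, |A3 t₀ x₀| ≤ W := fun t₀ x₀ => by rw [hA3]; dsimp only; rw [abs_abs]; exact hW t₀ x₀
  have hA12m : Measurable (uncurry fun t₀ x₀ => A1 t₀ x₀ + A2 t₀ x₀) := hA1m.add hA2m
  have hA12b : ∀ t₀ x₀, |A1 t₀ x₀ + A2 t₀ x₀| ≤ (CKr + σ ^ 3 * (CY * predBound L (ALam K δ ρb + 2 * max L 0))) + (CK + CKr) :=
    fun t₀ x₀ => (abs_add_le _ _).trans (add_le_add (hA1b t₀ x₀) (hA2b t₀ x₀))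
  have hSm : Measurable (uncurry fun t₀ x₀ => A1 t₀ x₀ + A2 t₀ x₀ + A3 t₀ x₀) := hA12m.add hA3m
  have hSb : ∀ t₀ x₀, |A1 t₀ x₀ + A2 t₀ x₀ + A3 t₀ x₀| ≤
      (CKr + σ ^ 3 * (CY * predBound L (ALam K δ ρb + 2 * max L 0))) + (CK + CKr) + W :=
    fun t₀ x₀ => (abs_add_le _ _).trans (add_le_add (hA12b t₀ x₀) (hA3b t₀ x₀))
  have h3 : ∫ t₀ in Set.Icc 0 τ, ∫ x₀, rW Φ σ τ r δ K L h Y z t₀ x₀ ≤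
      (∫ t₀ in Set.Icc 0 τ, ∫ x₀, A1 t₀ x₀) + (∫ t₀ in Set.Icc 0 τ, ∫ x₀, A2 t₀ x₀) + ∫ t₀ in Set.Icc 0 τ, ∫ x₀, A3 t₀ x₀ := by
    have hdom : ∀ t₀ ∈ Set.Icc (0 : ℝ) τ, ∀ x₀, |rW Φ σ τ r δ K L h Y z t₀ x₀| ≤ A1 t₀ x₀ + A2 t₀ x₀ + A3 t₀ x₀ := by
      intro t₀ _ x₀
      rw [hA1, hA2, hA3]; dsimp only
      have e : rW Φ σ τ r δ K L h Y z t₀ x₀ = -(krW Φ τ r δ K L h z t₀ x₀ - rW Φ σ τ r δ K L h Y z t₀ x₀) +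
          (-(kentW Φ τ r δ K h z t₀ x₀ - krW Φ τ r δ K L h z t₀ x₀)) + kentW Φ τ r δ K h z t₀ x₀ := by ring
      calc |rW Φ σ τ r δ K L h Y z t₀ x₀| = _ := congrArg _ e
        _ ≤ _ := (abs_add_le _ _).trans (add_le_add ((abs_add_le _ _).trans (add_le_add (le_of_eq (abs_neg _))
            (le_of_eq (abs_neg _)))) le_rfl)
    calc ∫ t₀ in Set.Icc 0 τ, ∫ x₀, rW Φ σ τ r δ K L h Y z t₀ x₀
        ≤ |∫ t₀ in Set.Icc 0 τ, ∫ x₀, rW Φ σ τ r δ K L h Y z t₀ x₀| := le_abs_self _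
      _ ≤ ∫ t₀ in Set.Icc 0 τ, ∫ x₀, (A1 t₀ x₀ + A2 t₀ x₀ + A3 t₀ x₀) := abs_setIntegral_integral_le_of_le hSm hSb hdom
      _ = _ := by rw [setIntegral_integral_add hA12m hA12b hA3m hA3b, setIntegral_integral_add hA1m hA1b hA2m hA2b]
  -- Step 4: the three bounds
  have h4 : ∫ t₀ in Set.Icc 0 τ, ∫ x₀, A2 t₀ x₀ ≤ Ch * (2 * ALam K δ ρb + 4) * csum Φ τ (fun s i j =>
      if L < ‖(Φ.flow s z i).2‖ ^ 2 + ‖(Φ.flow s z j).2‖ ^ 2 then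
        1 + ‖(Φ.flow s z i).2‖ ^ 2 + ‖(Φ.flow s z j).2‖ ^ 2 else 0) z := by
    rw [hA2]; exact kent_sub_kr_le Φ hz hσ hr hr2 hδ K L τ hCh hh0 hρb
  have h5 : ∫ t₀ in Set.Icc 0 τ, ∫ x₀, A3 t₀ x₀ ≤ τ * W := by
    have h := abs_setIntegral_integral_le hA3b hτ
    rw [sub_zero] at h
    exact (le_abs_self _).trans h
  -- assembly
  have h6 : ∫ s in Set.Icc 0 τ, ∫ x, G s x = 2 / σ ^ 3 * ∫ t₀ in Set.Icc 0 τ, ∫ x₀, rW Φ σ τ r δ K L h Y z t₀ x₀ := by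
    rw [h2, hGdef, setIntegral_integral_const_mul]
    field_simp
  rw [h6] at h1
  refine h1.trans (mul_le_mul_of_nonneg_left (h3.trans ?_) (by positivity))
  rw [hA1]
  linarith

end Transfer

/-! ## §2 The quartic collision functional against the tightness functional -/

section Q4

variable (Φ : HardSphereFlow (Torus.geometry (Fin 3)) (hsDiameter σ N) (N + 1)) {z : Phase N}

/-- The quartic comparison at one contact: `1 + |v|⁴ + |w|⁴ ≤ 2 (1 + |v′|⁴ + |w′|⁴)(1 + 1/(π|v′ − w′|))` whenever
`|v′|² + |w′|² = |v|² + |w|²`. [folklore] -/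
theorem quartic_term_le {v w v' w' : V3} (he : ‖v'‖ ^ 2 + ‖w'‖ ^ 2 = ‖v‖ ^ 2 + ‖w‖ ^ 2) :
    1 + ‖v‖ ^ 4 + ‖w‖ ^ 4 ≤ 2 * ((1 + ‖v'‖ ^ 4 + ‖w'‖ ^ 4) * (1 + 1 / (Real.pi * ‖v' - w'‖))) := by
  have hq : 0 ≤ 1 / (Real.pi * ‖v' - w'‖) := by positivity
  have h4v : ‖v‖ ^ 4 = (‖v‖ ^ 2) ^ 2 := by ring
  have h4w : ‖w‖ ^ 4 = (‖w‖ ^ 2) ^ 2 := by ring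
  have h4v' : ‖v'‖ ^ 4 = (‖v'‖ ^ 2) ^ 2 := by ring
  have h4w' : ‖w'‖ ^ 4 = (‖w'‖ ^ 2) ^ 2 := by ring
  have hkey : 1 + ‖v‖ ^ 4 + ‖w‖ ^ 4 ≤ 2 * (1 + ‖v'‖ ^ 4 + ‖w'‖ ^ 4) := by
    rw [h4v, h4w, h4v', h4w']
    nlinarith [sq_nonneg (‖v'‖ ^ 2 - ‖w'‖ ^ 2), sq_nonneg ‖v‖, sq_nonneg ‖w‖, mul_nonneg (sq_nonneg ‖v‖) (sq_nonneg ‖w‖)]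
  have h0 : 0 ≤ 1 + ‖v'‖ ^ 4 + ‖w'‖ ^ 4 := by positivity
  nlinarith [mul_nonneg h0 hq]

/-- **`Q4 ≤ 2 ×` the tightness functional**, pathwise along a good orbit: unfold the integral against the empirical
collision measure to the same collision sum (`HardSphereFlow.integral_empiricalCollisionMeasure_eq_finsum_ite`) and
compare termwise (the recorded pre-collisional pair has the same energy). [folklore] -/
theorem q4_le (hσ : 0 < σ) (hz : z ∈ Φ.good) (τ : ℝ) :
    csum Φ τ (fun s i j => 1 + ‖(Φ.flow s z i).2‖ ^ 4 + ‖(Φ.flow s z j).2‖ ^ 4) z ≤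
      2 * (hsDiameter σ N / (N + 1 : ℝ) *
        ∫ m, (1 + ‖m.2.2.2.1‖ ^ 4 + ‖m.2.2.2.2‖ ^ 4) * (1 + 1 / (Real.pi * ‖m.2.2.2.1 - m.2.2.2.2‖))
          ∂(Φ.empiricalCollisionMeasure (Set.Icc 0 τ) z)) := by
  -- adapted from `ChaosClosesEulerCollisionMomentUI.tail_functional_le`
  have hεN : 0 ≤ hsDiameter σ N / (N + 1 : ℝ) := div_nonneg (hsDiameter_pos hσ N).le (by positivity)
  have hfin := Φ.finite_collisionTimes_inter hz (Subset.refl (Set.Icc 0 τ))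
  unfold csum
  rw [Φ.integral_empiricalCollisionMeasure_eq_finsum_ite hz (Subset.refl (Set.Icc 0 τ)),
    finsum_mem_eq_finite_toFinset_sum _ hfin, finsum_mem_eq_finite_toFinset_sum _ hfin, mul_left_comm]
  refine mul_le_mul_of_nonneg_left ?_ hεN
  rw [Finset.mul_sum]
  refine Finset.sum_le_sum fun s _ => ?_
  rw [Finset.mul_sum]
  refine Finset.sum_le_sum fun i _ => ?_
  rw [Finset.mul_sum]
  refine Finset.sum_le_sum fun j _ => ?_
  by_cases hij : i ≠ j ∧ ‖(Torus.geometry (Fin 3)).sepVec (Φ.flow s z i).1 (Φ.flow s z j).1‖ = hsDiameter σ N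
  · rw [if_pos hij, if_pos hij]
    exact quartic_term_le (norm_sq_reflectVel_fst_add_norm_sq_reflectVel_snd _ ((Φ.flow s z i).2, (Φ.flow s z j).2))
  · simp only [if_neg hij, mul_zero, le_refl]

end Q4

/-! ## §3 Registered sub-goal -/

/-- **Registered sub-goal `stub_localEquilibriumFromDissipationF` (helper F of `stub_localEquilibriumFromDissipation`):
the quartic comparison at one contact.** [folklore] -/
theorem stub_localEquilibriumFromDissipationF : ∀ (v w v' w' : V3), ‖v'‖ ^ 2 + ‖w'‖ ^ 2 = ‖v‖ ^ 2 + ‖w‖ ^ 2 → 1 + ‖v‖ ^ 4 + ‖w‖ ^ 4 ≤ 2 * ((1 + ‖v'‖ ^ 4 + ‖w'‖ ^ 4) * (1 + 1 / (Real.pi * ‖v' - w'‖))) :=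
  fun _ _ _ _ he => quartic_term_le he

end Summit.AtomisticToContinuum.HydrodynamicLimit.Theorems.ChaosClosesEulerLocalEquilibriumFromDissipation

end
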